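import Literature.AlgebraicGeometry.Modules.CechFullCochainRawReading
import Literature.AlgebraicGeometry.Modules.CechPullbackSystemHom
import HarnessLib

/-!
# Pull-backs and refinements of full Čech cochains of `𝒪_X`, read in the raw module Čech dialect:
# `Full.pullbackCochain θ (pullbackSystemHom g …)` reads as `cechMRefineC2 θ ∘ cechComapC2 g`
# (The Stacks Project, Tags 01ED, 01FG; Görtz–Wedhorn II, Def. 21.68, (21.16) Def. 21.71)

Topic `AlgebraicGeometry/Modules`; namespace `Literature.AlgebraicGeometry.Modules`.  THEOREMS ONLY (no `def`, no instance, no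
notation, no named fact, no `sorry`).  Cell `hodgecm-mathlib` FLOOR 0, P1 sub-line F-11, MONO-G1 slot (5) `hrel₃`, road (R109) of
F0P1b-plan (g2): piece **N3′ DICTIONARY COMPAT, FILE 2** (FILE 1 = ★ `Modules/CechFullCochainRawReading`), consumed by the
assembly N4 (F0P1b-p04 (g2)): the ordered∕full pull-backs `[2]^*`, `ref` of N1 (`[2]^* = 4` on `Ȟ²(𝒪)`) must be identified with
the raw `cechMRefineC2 τ′ (cechComapC2 [2] z)`, `cechMRefineC2 τ z` of the letter of B-p14 (g21)'s socket.

Setting: a morphism of `A`-schemes `g : Y ⟶ X` (`hg : g ≫ f_X = f_Y`), families of opens `𝓤 = (U_i)_{i ∈ ι}` on `X` and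
`𝓥 = (V_c)_{c ∈ ι′}` on `Y` (linearly ordered index types), an ADMISSIBLE index map `θ : ι′ → ι` (`hθ : V_c ⊆ g⁻¹ U_{θ c}` — the
same term serves ★ `Modules.pullbackSystemHom` and, since ★ `preimageFamily g 𝓤 = (g⁻¹U_i)_i` is an `abbrev`, ★ `cechMRefineC2`),
and `A`-structures `ρ_X`, `ρ_Y` with `ρ_Y = g^* ∘ ρ_X`.  The full side has the pull-back of cochains
`Θ := Full.pullbackCochain θ (pullbackSystemHom g 𝓤 𝓥 θ hθ ρ_X ρ_Y hρ)` (★ `Algebra/Homology/OrderedCechSystemFull`,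
★ `Modules/CechPullbackSystemHom`); the raw side has `g^* = cechComapC2 f_X f_Y g hg 𝓤 : Č²(𝓤) → Č²(g⁻¹𝓤)` (★ `Morphisms/CechH1Pullback`,
on `𝒪 = SheafOfModules.unit` by ★ `Morphisms/CechModuleUnitH2Pullback`) and the refinement `cechMRefineC2 … θ hθ : Č²(g⁻¹𝓤) → Č²(𝓥)`
(★ `Morphisms/CechModuleH2Refinement`).  With the raw reading of FILE 1 (`c ↦ ((j,l,m) ↦ c(j,l,m)|_{U_j ∩ U_l ∩ U_m})`):

* §1 `map_toRing_pullbackCochain` — `(Θ c)(α′)|_W = g^*(c(θ ∘ α′))|_W` (`Scheme.Hom.appLE`) for every `W ⊆ V_{ {α′} }`;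
  **`map_toRing_pullbackCochain_two`** ∕ `_one` — raw reading of `Θ c` = `cechMRefineC2 θ (cechComapC2 g (raw c))` (resp. degree `1`);
  **`toRing_pullbackCochain_two_of_forall_toRing_eq`** — the same in the `hc` convention of ★ `CechFullCochainRawDegreeTwo`
  (`c` the transport of `s` ⇒ `(Θ c)(β) = (cechMRefineC2 θ (cechComapC2 g s))(β 0, β 1, β 2)|_{V_{ {β} }}`);
* §2 along `g = 𝟙 X` (plain refinement of covers of `X`): `map_toRing_pullbackCochain_id`, **`map_toRing_pullbackCochain_id_two`** ∕
  `_one`, **`toRing_pullbackCochain_id_two_of_forall_toRing_eq`** — the full pull-back along `θ` reads as `cechMRefineC2 θ` itself;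
* §3 the six relational letters («`c` READS `s`»: `∀ j l m, s j l m = c(j,l,m)|_{U_j ∩ U_l ∩ U_m}`) in the binder order of the
  consumer N4: `exists_full_reads_rawTwo`, `full_d_two_eq_zero_of_reads_of_mem_cechMZ2`,
  `cechMRefineC2_comapC2_eq_map_toRing_pullbackCochain`, `cechMRefineC2_eq_map_toRing_pullbackCochain_id`,
  `mem_cechMB2_of_reads_full_d_one`, `sub_smul_apply_eq_map_toRing_of_reads`.

[StacksProject, Tag 01ED: functoriality of the Čech complex in the pair (space, covering); Tag 01FG: refinements;
GortzWedhorn2023, (21.16) Def. 21.71: the map of Čech complexes along a map of coverings.]  Mathlib (pin v4.32) has no Čech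
cohomology of schemes; the proofs are `Scheme.Hom.map_appLE` ∕ `appLE_map` bookkeeping.  HC_CM is proved only modulo the 7
printed citations until rung 0 closes; nothing here refers to it.

## References
* The Stacks Project, Tag 01ED (Čech complex of `𝒪_X`, functoriality), Tag 01FG (all tuples; refinements). [StacksProject]
* U. Görtz, T. Wedhorn, *Algebraic Geometry II: Cohomology of Schemes* (2023), Def. 21.68 (p. 180), (21.16) Def. 21.71 (p. 181).
  [GortzWedhorn2023]
* R. Godement, *Topologie algébrique et théorie des faisceaux* (1958), II §5.8. [Godement1958]
-/

noncomputable section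

open CategoryTheory AlgebraicGeometry TopologicalSpace Opposite
open Literature.Algebra.Homology Literature.Algebra.Homology.OrderedCech
open Literature.AlgebraicGeometry.Morphisms

set_option backward.isDefEq.respectTransparency false -- `ModuleCat`-valued functors (as in ★ `OrderedCechSystemFull`)

universe u

namespace Literature.AlgebraicGeometry.Modules

/-! ## §0 Plumbing: reindexed tuples, admissible index maps on tuples -/

section Plumbing

variable {X : Scheme.{u}} {ι ι' : Type} [LinearOrder ι] [LinearOrder ι'] (U : ι → X.Opens)

omit [LinearOrder ι] [LinearOrder ι'] in
/-- Reindexing a triple along a map of index sets. [cite: StacksProject, Tag 01FG] -/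
theorem comp_vecCons₃ (θ : ι' → ι) (j l m : ι') : θ ∘ ![j, l, m] = ![θ j, θ l, θ m] := by
  funext k; fin_cases k <;> rfl

omit [LinearOrder ι] [LinearOrder ι'] in
/-- Reindexing a pair along a map of index sets. [cite: StacksProject, Tag 01FG] -/
theorem comp_vecCons₂ (θ : ι' → ι) (j l : ι') : θ ∘ ![j, l] = ![θ j, θ l] := by
  funext k; fin_cases k <;> rfl

omit [LinearOrder ι'] in
/-- **`V_{s′} ⊆ U_{θ(s′)}`** for an index map with `V_c ⊆ U_{θ c}` (plain refinement; the `g = 𝟙` case of ★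
`cechOpen_le_preimage_cechOpen_image`). [cite: StacksProject, Tag 01FG] -/
theorem cechOpen_le_cechOpen_image_of_le (V : ι' → X.Opens) (θ : ι' → ι) (hθ : ∀ c, V c ≤ U (θ c)) (s' : Finset ι') :
    cechOpen V s' ≤ cechOpen U (s'.image θ) := by
  unfold cechOpen
  rw [Finset.inf_image]
  exact Finset.inf_mono_fun fun c _ => hθ c

/-- `W ⊆ V_{ {α′} } ⊆ U_{ {θ ∘ α′} }` for an index map with `V_c ⊆ U_{θ c}`. [cite: StacksProject, Tag 01FG] -/
theorem le_cechOpen_image_comp (V : ι' → X.Opens) (θ : ι' → ι) (hθ : ∀ c, V c ≤ U (θ c)) {n : ℕ} (α' : Fin (n + 1) → ι')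
    {W : X.Opens} (hW : W ≤ cechOpen V (Finset.univ.image α')) : W ≤ cechOpen U (Finset.univ.image (θ ∘ α')) := by
  rw [Full.image_comp_eq]
  exact hW.trans (cechOpen_le_cechOpen_image_of_le U V θ hθ _)

omit [LinearOrder ι] in
/-- Composite restrictions of functions (plumbing). [folklore] -/
private theorem resFun_trans {U₁ U₂ U₃ : X.Opens} (h₁ : U₂ ≤ U₁) (h₂ : U₃ ≤ U₂) (x : Γ(X, U₁)) :
    X.presheaf.map (homOfLE h₂).op (X.presheaf.map (homOfLE h₁).op x) = X.presheaf.map (homOfLE (h₂.trans h₁)).op x := by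
  rw [← CommRingCat.comp_apply, ← Functor.map_comp]
  rfl

end Plumbing

/-! ## §1 The full pull-back along `g : Y ⟶ X` read in raw letters: «pull back along `g`, refine along `θ`» -/

section Pullback

variable {A : Type u} [CommRing A] {X Y : Scheme.{u}} (fX : X ⟶ Spec (.of A)) (fY : Y ⟶ Spec (.of A))
  (g : Y ⟶ X) (hg : g ≫ fX = fY)
  {ι ι' : Type} [LinearOrder ι] [LinearOrder ι'] (U : ι → X.Opens) (V : ι' → Y.Opens) (θ : ι' → ι)
  (hθ : ∀ c, V c ≤ g ⁻¹ᵁ U (θ c)) (ρX : A →+* Γ(X, ⊤)) (ρY : A →+* Γ(Y, ⊤)) (hρ : ∀ a, ρY a = g.appTop (ρX a))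

include hθ in
/-- `W ⊆ V_{ {α′} } ⊆ g⁻¹ U_{ {θ ∘ α′} }` (the admissible index map on tuples). [cite: StacksProject, Tag 01FG] -/
theorem le_preimage_cechOpen_image_comp {n : ℕ} (α' : Fin (n + 1) → ι') {W : Y.Opens}
    (hW : W ≤ cechOpen V (Finset.univ.image α')) : W ≤ g ⁻¹ᵁ cechOpen U (Finset.univ.image (θ ∘ α')) := by
  rw [Full.image_comp_eq]
  exact hW.trans (cechOpen_le_preimage_cechOpen_image g U V θ hθ _)

/-- **The full pull-back read on `W ⊆ V_{ {α′} }`**: `(Θ c)(α′)|_W = g^*(c(θ ∘ α′))|_W` (`Scheme.Hom.appLE`), in every degree.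
[cite: StacksProject, Tag 01ED] [cite: GortzWedhorn2023, Def. 21.68 (p. 180)] -/
theorem map_toRing_pullbackCochain {n : ℕ} (c : Full.Cochain (sectionsSystem U (unitModule X) ρX) n)
    (α' : Fin (n + 1) → ι') {W : Y.Opens} (hW : W ≤ cechOpen V (Finset.univ.image α')) :
    Y.presheaf.map (homOfLE hW).op
        (SecMod.toRing ρY (Full.pullbackCochain θ (pullbackSystemHom g U V θ hθ ρX ρY hρ) n c α')) =
      g.appLE (cechOpen U (Finset.univ.image (θ ∘ α'))) W (le_preimage_cechOpen_image_comp g U V θ hθ α' hW)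
        (SecMod.toRing ρX (c (θ ∘ α'))) := by
  rw [Full.pullbackCochain_apply, toRing_pullbackSystemHom_app, toRing_sectionsSystem_map]
  change ((X.presheaf.map (homOfLE _).op ≫ g.appLE _ _ _) ≫ Y.presheaf.map (homOfLE hW).op) (SecMod.toRing ρX (c (θ ∘ α'))) = _
  rw [Scheme.Hom.map_appLE, Scheme.Hom.appLE_map]

/-- Transport of `g^*(c α)|` along an equality of tuples. [cite: StacksProject, Tag 01FG] -/
private theorem appLE_toRing_congr {n : ℕ} (c : Full.Cochain (sectionsSystem U (unitModule X) ρX) n) {α α' : Fin (n + 1) → ι}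
    (h : α = α') {W : Y.Opens} (e : W ≤ g ⁻¹ᵁ cechOpen U (Finset.univ.image α)) (e' : W ≤ g ⁻¹ᵁ cechOpen U (Finset.univ.image α')) :
    g.appLE _ W e (SecMod.toRing ρX (c α)) = g.appLE _ W e' (SecMod.toRing ρX (c α')) := by
  subst h
  rfl

/-- **DEGREE 2: the raw reading of the full pull-back is `cechMRefineC2 θ ∘ cechComapC2 g` of the raw reading** —
`(Θ c)(j,l,m)|_{V_j ∩ V_l ∩ V_m} = (g^* c(θ j, θ l, θ m))|_{V_j ∩ V_l ∩ V_m}` («pull back to `g⁻¹𝓤`, refine to `𝓥` along `θ`»).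
[cite: StacksProject, Tag 01ED] [cite: GortzWedhorn2023, (21.16) Def. 21.71 (p. 181)] -/
theorem map_toRing_pullbackCochain_two (c : Full.Cochain (sectionsSystem U (unitModule X) ρX) 2) (j l m : ι') :
    Y.presheaf.map (homOfLE (inf_le_cechOpen_triple V j l m)).op
        (SecMod.toRing ρY (Full.pullbackCochain θ (pullbackSystemHom g U V θ hθ ρX ρY hρ) 2 c ![j, l, m])) =
      cechMRefineC2 fY (unitModule Y) (preimageFamily g U) V θ hθ
        (cechComapC2 fX fY g hg U (fun j l m =>
            X.presheaf.map (homOfLE (inf_le_cechOpen_triple U j l m)).op (SecMod.toRing ρX (c ![j, l, m]))) :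
          CechMC2 fY (unitModule Y) (preimageFamily g U)) j l m := by
  rw [map_toRing_pullbackCochain]
  simp only [cechMRefineC2_apply, cechComapC2_apply, MSections.res_unit, Sections.res_apply, Sections.comap_apply]
  change _ = ((X.presheaf.map (homOfLE _).op ≫ g.appLE _ _ _) ≫ Y.presheaf.map (homOfLE _).op) (SecMod.toRing ρX (c ![θ j, θ l, θ m]))
  rw [Scheme.Hom.map_appLE, Scheme.Hom.appLE_map]
  exact appLE_toRing_congr g U ρX c (comp_vecCons₃ θ j l m) _ _

/-- **DEGREE 1: the raw reading of the full pull-back is `cechMRefineC1 θ ∘ cechComapC1 g` of the raw reading.**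
[cite: StacksProject, Tag 01ED] [cite: GortzWedhorn2023, (21.16) Def. 21.71 (p. 181)] -/
theorem map_toRing_pullbackCochain_one (c : Full.Cochain (sectionsSystem U (unitModule X) ρX) 1) (j l : ι') :
    Y.presheaf.map (homOfLE (inf_le_cechOpen_pair V j l)).op
        (SecMod.toRing ρY (Full.pullbackCochain θ (pullbackSystemHom g U V θ hθ ρX ρY hρ) 1 c ![j, l])) =
      cechMRefineC1 fY (unitModule Y) (preimageFamily g U) V θ hθ
        (cechComapC1 fX fY g hg U (fun j l =>
            X.presheaf.map (homOfLE (inf_le_cechOpen_pair U j l)).op (SecMod.toRing ρX (c ![j, l]))) :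
          CechMC1 fY (unitModule Y) (preimageFamily g U)) j l := by
  rw [map_toRing_pullbackCochain]
  simp only [cechMRefineC1_apply, cechComapC1_apply, MSections.res_unit, Sections.res_apply, Sections.comap_apply]
  change _ = ((X.presheaf.map (homOfLE _).op ≫ g.appLE _ _ _) ≫ Y.presheaf.map (homOfLE _).op) (SecMod.toRing ρX (c ![θ j, θ l]))
  rw [Scheme.Hom.map_appLE, Scheme.Hom.appLE_map]
  exact appLE_toRing_congr g U ρX c (comp_vecCons₂ θ j l) _ _

/-- **DEGREE 2, `hc` convention of ★ `CechFullCochainRawDegreeTwo`**: if `c` is the transport of the raw `2`-cochain `s`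
(`c α = s(α₀,α₁,α₂)|_{U_{ {α} }}`), then `(Θ c)(β) = (cechMRefineC2 θ (cechComapC2 g s))(β 0, β 1, β 2)|_{V_{ {β} }}` for every
`2`-tuple `β`. [cite: StacksProject, Tag 01ED] [cite: GortzWedhorn2023, (21.16) Def. 21.71 (p. 181)] -/
theorem toRing_pullbackCochain_two_of_forall_toRing_eq (s : CechMC2 fX (unitModule X) U)
    (c : Full.Cochain (sectionsSystem U (unitModule X) ρX) 2)
    (hc : ∀ α : Fin (2 + 1) → ι, SecMod.toRing ρX (c α) =
      X.presheaf.map (homOfLE (cechOpen_image_le_inf₃ U α)).op (s (α 0) (α 1) (α 2)))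
    (β : Fin (2 + 1) → ι') :
    SecMod.toRing ρY (Full.pullbackCochain θ (pullbackSystemHom g U V θ hθ ρX ρY hρ) 2 c β) =
      Y.presheaf.map (homOfLE (cechOpen_image_le_inf₃ V β)).op
        (cechMRefineC2 fY (unitModule Y) (preimageFamily g U) V θ hθ
          (cechComapC2 fX fY g hg U s : CechMC2 fY (unitModule Y) (preimageFamily g U)) (β 0) (β 1) (β 2)) := by
  have hs : ((fun j l m => X.presheaf.map (homOfLE (inf_le_cechOpen_triple U j l m)).op (SecMod.toRing ρX (c ![j, l, m]))) :
      CechMC2 fX (unitModule X) U) = s :=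
    funext fun j => funext fun l => funext fun m => (forall_toRing_eq_iff_forall_rawTwo_eq fX U ρX c s).1 hc j l m
  refine (forall_toRing_eq_iff_forall_rawTwo_eq fY V ρY _ _).2 (fun j l m => ?_) β
  rw [map_toRing_pullbackCochain_two fX fY g hg U V θ hθ ρX ρY hρ c j l m, ← hs]

end Pullback

/-! ## §2 Along the identity: the full pull-back along `θ` reads as the plain refinement `cechMRefineC2 θ` -/

section Refine

variable {A : Type u} [CommRing A] {X : Scheme.{u}} (fX : X ⟶ Spec (.of A))
  {ι ι' : Type} [LinearOrder ι] [LinearOrder ι'] (U : ι → X.Opens) (V : ι' → X.Opens) (θ : ι' → ι)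
  (hθ₁ : ∀ c, V c ≤ (𝟙 X : X ⟶ X) ⁻¹ᵁ U (θ c)) (hθ : ∀ c, V c ≤ U (θ c)) (ρ : A →+* Γ(X, ⊤))
  (hρ₁ : ∀ a, ρ a = (𝟙 X : X ⟶ X).appTop (ρ a))

include hθ in
/-- **Along `𝟙 X` the full pull-back read on `W ⊆ V_{ {α′} }` is the restriction `c(θ ∘ α′)|_W`** (`hθ₁`∕`hθ` are the same
inclusions `V_c ⊆ U_{θ c}`, spelled for ★ `pullbackSystemHom (𝟙 X)` resp. for the restriction). [cite: StacksProject, Tag 01FG] -/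
theorem map_toRing_pullbackCochain_id {n : ℕ} (c : Full.Cochain (sectionsSystem U (unitModule X) ρ) n)
    (α' : Fin (n + 1) → ι') {W : X.Opens} (hW : W ≤ cechOpen V (Finset.univ.image α')) :
    X.presheaf.map (homOfLE hW).op
        (SecMod.toRing ρ (Full.pullbackCochain θ (pullbackSystemHom (𝟙 X) U V θ hθ₁ ρ ρ hρ₁) n c α')) =
      X.presheaf.map (homOfLE (le_cechOpen_image_comp U V θ hθ α' hW)).op (SecMod.toRing ρ (c (θ ∘ α'))) := by
  rw [map_toRing_pullbackCochain, Scheme.Hom.appLE, Scheme.Hom.id_app, Category.id_comp]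

/-- **DEGREE 2, along `𝟙 X`: the raw reading of the full pull-back along `θ` is the refinement `cechMRefineC2 θ` of the raw
reading.** [cite: StacksProject, Tag 01FG] [cite: GortzWedhorn2023, (21.16) Def. 21.71 (p. 181)] -/
theorem map_toRing_pullbackCochain_id_two (c : Full.Cochain (sectionsSystem U (unitModule X) ρ) 2) (j l m : ι') :
    X.presheaf.map (homOfLE (inf_le_cechOpen_triple V j l m)).op
        (SecMod.toRing ρ (Full.pullbackCochain θ (pullbackSystemHom (𝟙 X) U V θ hθ₁ ρ ρ hρ₁) 2 c ![j, l, m])) =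
      cechMRefineC2 fX (unitModule X) U V θ hθ
        ((fun j l m => X.presheaf.map (homOfLE (inf_le_cechOpen_triple U j l m)).op (SecMod.toRing ρ (c ![j, l, m]))) :
          CechMC2 fX (unitModule X) U) j l m := by
  rw [map_toRing_pullbackCochain_id U V θ hθ₁ hθ ρ hρ₁]
  simp only [cechMRefineC2_apply, MSections.res_unit, Sections.res_apply]
  rw [resFun_trans]
  exact map_toRing_apply_congr U ρ c (comp_vecCons₃ θ j l m) _ _

/-- **DEGREE 1, along `𝟙 X`: the raw reading of the full pull-back along `θ` is `cechMRefineC1 θ` of the raw reading.**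
[cite: StacksProject, Tag 01FG] [cite: GortzWedhorn2023, (21.16) Def. 21.71 (p. 181)] -/
theorem map_toRing_pullbackCochain_id_one (c : Full.Cochain (sectionsSystem U (unitModule X) ρ) 1) (j l : ι') :
    X.presheaf.map (homOfLE (inf_le_cechOpen_pair V j l)).op
        (SecMod.toRing ρ (Full.pullbackCochain θ (pullbackSystemHom (𝟙 X) U V θ hθ₁ ρ ρ hρ₁) 1 c ![j, l])) =
      cechMRefineC1 fX (unitModule X) U V θ hθ
        ((fun j l => X.presheaf.map (homOfLE (inf_le_cechOpen_pair U j l)).op (SecMod.toRing ρ (c ![j, l]))) :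
          CechMC1 fX (unitModule X) U) j l := by
  rw [map_toRing_pullbackCochain_id U V θ hθ₁ hθ ρ hρ₁]
  simp only [cechMRefineC1_apply, MSections.res_unit, Sections.res_apply]
  rw [resFun_trans]
  exact map_toRing_apply_congr U ρ c (comp_vecCons₂ θ j l) _ _

/-- **DEGREE 2, along `𝟙 X`, `hc` convention**: if `c` is the transport of the raw `2`-cochain `s`, then
`(Θ c)(β) = (cechMRefineC2 θ s)(β 0, β 1, β 2)|_{V_{ {β} }}`. [cite: StacksProject, Tag 01FG] [cite: GortzWedhorn2023, (21.16) Def. 21.71 (p. 181)] -/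
theorem toRing_pullbackCochain_id_two_of_forall_toRing_eq (s : CechMC2 fX (unitModule X) U)
    (c : Full.Cochain (sectionsSystem U (unitModule X) ρ) 2)
    (hc : ∀ α : Fin (2 + 1) → ι, SecMod.toRing ρ (c α) =
      X.presheaf.map (homOfLE (cechOpen_image_le_inf₃ U α)).op (s (α 0) (α 1) (α 2)))
    (β : Fin (2 + 1) → ι') :
    SecMod.toRing ρ (Full.pullbackCochain θ (pullbackSystemHom (𝟙 X) U V θ hθ₁ ρ ρ hρ₁) 2 c β) =
      X.presheaf.map (homOfLE (cechOpen_image_le_inf₃ V β)).op (cechMRefineC2 fX (unitModule X) U V θ hθ s (β 0) (β 1) (β 2)) := by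
  have hs : ((fun j l m => X.presheaf.map (homOfLE (inf_le_cechOpen_triple U j l m)).op (SecMod.toRing ρ (c ![j, l, m]))) :
      CechMC2 fX (unitModule X) U) = s :=
    funext fun j => funext fun l => funext fun m => (forall_toRing_eq_iff_forall_rawTwo_eq fX U ρ c s).1 hc j l m
  refine (forall_toRing_eq_iff_forall_rawTwo_eq fX V ρ _ _).2 (fun j l m => ?_) β
  rw [map_toRing_pullbackCochain_id_two fX U V θ hθ₁ hθ ρ hρ₁ c j l m, ← hs]

end Refine

/-! ## §3 Socket forms for the transport N4 (F0P1b-p04 (g2)): relational letters «`c` READS `s`»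
(`∀ j l m, s j l m = c(j,l,m)|_{U_j ∩ U_l ∩ U_m}`), binders in the consumer's order -/

section Sockets

variable {X Y : Scheme.{u}} {ι ι' : Type} [LinearOrder ι] [LinearOrder ι'] (U : ι → X.Opens) (V : ι' → Y.Opens)
  {A : Type u} [CommRing A] (ρ : A →+* Γ(X, ⊤)) (ρ' : A →+* Γ(Y, ⊤))
  (fX : X ⟶ Spec (.of A)) (fY : Y ⟶ Spec (.of A)) (g : Y ⟶ X) (hg : g ≫ fX = fY)

/-- **Every raw `2`-cochain is read by a full one** (relational form of ★ `exists_rawTwo_eq`). [cite: StacksProject, Tag 01FG] -/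
theorem exists_full_reads_rawTwo (s : CechMC2 fX (unitModule X) U) :
    ∃ c : Full.Cochain (sectionsSystem U (unitModule X) ρ) 2,
      ∀ j l m, s j l m = X.presheaf.map (homOfLE (inf_le_cechOpen_triple U j l m)).op (SecMod.toRing ρ (c ![j, l, m])) := by
  obtain ⟨c, hc⟩ := exists_rawTwo_eq fX U ρ s
  exact ⟨c, fun j l m => (hc j l m).symm⟩

/-- **A full `2`-cochain reading a raw `2`-cocycle is a cocycle of `Full.complex S`** (relational form of ★
`full_d_two_eq_zero_of_mem_cechMZ2`). [cite: StacksProject, Tag 01FG] -/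
theorem full_d_two_eq_zero_of_reads_of_mem_cechMZ2 (c : Full.Cochain (sectionsSystem U (unitModule X) ρ) 2)
    (s : CechMC2 fX (unitModule X) U) (hs : s ∈ cechMZ2 fX (unitModule X) U)
    (hc : ∀ j l m, s j l m = X.presheaf.map (homOfLE (inf_le_cechOpen_triple U j l m)).op (SecMod.toRing ρ (c ![j, l, m]))) :
    ((Full.complex (sectionsSystem U (unitModule X) ρ)).d 2 3).hom c = 0 :=
  full_d_two_eq_zero_of_mem_cechMZ2 fX U ρ c s hs fun j l m => (hc j l m).symm

include hg in
/-- **The refined pull-back `cechMRefineC2 θ (cechComapC2 g s)` of the raw reading `s` of `c` is the raw reading of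
`Full.pullbackCochain θ (pullbackSystemHom g …) c`** (relational form of `map_toRing_pullbackCochain_two`).
[cite: StacksProject, Tag 01ED] [cite: GortzWedhorn2023, (21.16) Def. 21.71 (p. 181)] -/
theorem cechMRefineC2_comapC2_eq_map_toRing_pullbackCochain (θ : ι' → ι) (hθ : ∀ c, V c ≤ g ⁻¹ᵁ U (θ c))
    (hρ : ∀ a, ρ' a = g.appTop (ρ a)) (c : Full.Cochain (sectionsSystem U (unitModule X) ρ) 2)
    (s : CechMC2 fX (unitModule X) U)
    (hc : ∀ j l m, s j l m = X.presheaf.map (homOfLE (inf_le_cechOpen_triple U j l m)).op (SecMod.toRing ρ (c ![j, l, m])))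
    (j l m : ι') :
    cechMRefineC2 fY (unitModule Y) (preimageFamily g U) V θ hθ (cechComapC2 fX fY g hg U s) j l m =
      Y.presheaf.map (homOfLE (inf_le_cechOpen_triple V j l m)).op
        (SecMod.toRing ρ' (Full.pullbackCochain θ (pullbackSystemHom g U V θ hθ ρ ρ' hρ) 2 c ![j, l, m])) := by
  have hs : ((fun j l m => X.presheaf.map (homOfLE (inf_le_cechOpen_triple U j l m)).op (SecMod.toRing ρ (c ![j, l, m]))) :
      CechMC2 fX (unitModule X) U) = s :=
    funext fun j => funext fun l => funext fun m => (hc j l m).symm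
  rw [map_toRing_pullbackCochain_two fX fY g hg U V θ hθ ρ ρ' hρ c j l m, ← hs]

/-- **Along `𝟙 X`: the refinement `cechMRefineC2 θ s` of the raw reading `s` of `c` is the raw reading of the full pull-back of
`c` along `θ`** (relational form of `map_toRing_pullbackCochain_id_two`). [cite: StacksProject, Tag 01FG]
[cite: GortzWedhorn2023, (21.16) Def. 21.71 (p. 181)] -/
theorem cechMRefineC2_eq_map_toRing_pullbackCochain_id (V₁ : ι' → X.Opens) (θ : ι' → ι)
    (hθ₁ : ∀ c, V₁ c ≤ (𝟙 X : X ⟶ X) ⁻¹ᵁ U (θ c)) (hθ : ∀ c, V₁ c ≤ U (θ c)) (hρ₁ : ∀ a, ρ a = (𝟙 X : X ⟶ X).appTop (ρ a))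
    (c : Full.Cochain (sectionsSystem U (unitModule X) ρ) 2) (s : CechMC2 fX (unitModule X) U)
    (hc : ∀ j l m, s j l m = X.presheaf.map (homOfLE (inf_le_cechOpen_triple U j l m)).op (SecMod.toRing ρ (c ![j, l, m])))
    (j l m : ι') :
    cechMRefineC2 fX (unitModule X) U V₁ θ hθ s j l m =
      X.presheaf.map (homOfLE (inf_le_cechOpen_triple V₁ j l m)).op
        (SecMod.toRing ρ (Full.pullbackCochain θ (pullbackSystemHom (𝟙 X) U V₁ θ hθ₁ ρ ρ hρ₁) 2 c ![j, l, m])) := by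
  have hs : ((fun j l m => X.presheaf.map (homOfLE (inf_le_cechOpen_triple U j l m)).op (SecMod.toRing ρ (c ![j, l, m]))) :
      CechMC2 fX (unitModule X) U) = s :=
    funext fun j => funext fun l => funext fun m => (hc j l m).symm
  rw [map_toRing_pullbackCochain_id_two fX U V₁ θ hθ₁ hθ ρ hρ₁ c j l m, ← hs]

/-- **A raw `2`-cochain read by a full `2`-coboundary `d w` is a raw `2`-coboundary** (relational form of ★
`mem_cechMB2_of_eq_full_d`). [cite: StacksProject, Tag 01FG] -/
theorem mem_cechMB2_of_reads_full_d_one (w : Full.Cochain (sectionsSystem U (unitModule X) ρ) 1)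
    (s : CechMC2 fX (unitModule X) U)
    (hc : ∀ j l m, s j l m = X.presheaf.map (homOfLE (inf_le_cechOpen_triple U j l m)).op
      (SecMod.toRing ρ (((Full.complex (sectionsSystem U (unitModule X) ρ)).d 1 2).hom w ![j, l, m]))) :
    s ∈ cechMB2 fX (unitModule X) U := by
  have hs : ((fun j l m => X.presheaf.map (homOfLE (inf_le_cechOpen_triple U j l m)).op
      (SecMod.toRing ρ (((Full.complex (sectionsSystem U (unitModule X) ρ)).d 1 2).hom w ![j, l, m]))) :
        CechMC2 fX (unitModule X) U) = s :=
    funext fun j => funext fun l => funext fun m => (hc j l m).symm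
  rw [← hs]
  exact mem_cechMB2_of_eq_full_d fX U ρ w _ rfl

/-- **Readings are compatible with `c ↦ c − c₀ • c′`** (`ρ = algebraMapΓ f`; relational form of ★ `rawTwo_sub` ∕ ★ `rawTwo_smul`).
[cite: GortzWedhorn2023, Def. 21.68 (p. 180)] -/
theorem sub_smul_apply_eq_map_toRing_of_reads (hρf : ∀ a, ρ a = algebraMapΓ fX a) (c₀ : A)
    (c c' : Full.Cochain (sectionsSystem U (unitModule X) ρ) 2) (s s' : CechMC2 fX (unitModule X) U)
    (hc : ∀ j l m, s j l m = X.presheaf.map (homOfLE (inf_le_cechOpen_triple U j l m)).op (SecMod.toRing ρ (c ![j, l, m])))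
    (hc' : ∀ j l m, s' j l m = X.presheaf.map (homOfLE (inf_le_cechOpen_triple U j l m)).op (SecMod.toRing ρ (c' ![j, l, m])))
    (j l m : ι) :
    (s - c₀ • s') j l m =
      X.presheaf.map (homOfLE (inf_le_cechOpen_triple U j l m)).op (SecMod.toRing ρ ((c - c₀ • c') ![j, l, m])) :=
  (rawTwo_sub fX U ρ c (c₀ • c') s (c₀ • s') (fun j l m => (hc j l m).symm)
    (rawTwo_smul fX U ρ hρf c₀ c' s' fun j l m => (hc' j l m).symm) j l m).symm

end Sockets

end Literature.AlgebraicGeometry.Modules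

end
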